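import Summits.NavierStokesRegularity.NavierStokesRegularity.Theorems.PalasekTowerBreakdownHeredityFromTwoGlobal
import Literature.Analysis.FluidPDE.AxisymmetricNoSwirlGlobalHolds

/-!
# NavierStokesRegularity — route `PalasekTowerBreakdown`: under the child crux `HeredityFromTwo` the
# UNFORCED AXISYMMETRIC SWIRL-FREE register is EMPTY at every generic level — the `∀`-form lever with
# its cap DISCHARGED by the tree (Ladyzhenskaya / Ukhovskii–Yudovich)

Supports `stmt-NavierStokesRegularity-19250` (`PalasekTowerBreakdown.HeredityFromTwo := HeredityFrom 2`);
third file of the series `…HeredityFromTwoRung` (p445539: one generic rung climbs the ladder) /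
`…HeredityFromTwoGlobal` (p446478: a rung-carrying design has no classical finite-energy solution on
`[0, S.T]`). Cell `ns-blowup`, seat `ns-palasek-19250-p1` (g0). LABEL: E–C typing + kernel bookkeeping
(theorems only; no definition; NO named fact — the global regularity of axisymmetric swirl-free flows
is the tree's DISCHARGED theorem `Literature.Analysis.FluidPDE.axisymmetric_no_swirl_global_regularity_holds`,
Lemarié-Rieusset 2016 Thm. 10.4 after Ladyzhenskaya 1968 / Ukhovskii–Yudovich 1968). WHAT THIS IS
NOT: not Navier–Stokes evidence and NOT a refutation of the item — no stage is constructed; the ONE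
remaining hypothesis of the refutation template below is an OPEN CONSTRUCTION (a registered unforced
axisymmetric swirl-free stage at a level `≥ 2`; planner g18 STATUS l.3900/l.3948: ring children are
kinematically short of the register's Burgers polytope at `TowerRates.wide`, so the class may well be
empty for kinematic reasons — in which case the child is simply vacuous there).

Tribunal T2's `∀`-form supplement (t2-r3-forall-cap-supplement.md 3eec0c4d45769a4d) and planner g18
(STATUS l.3948 (B)): refuting the `∀`-binder `HeredityFrom 2` needs «a registered no-swirl LEVEL-2 stage
but only QUALITATIVE all-time boundedness». For UNFORCED designs (`S.f ≡ 0` on `[0, ∞)` — admissible: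
`TowerRates.exists_registered_schedule`; then `Quiet` and `push_small` are free and the datum `S.u₀` is
a Clay datum, smooth and divergence free as the slice `t = 0` of any stage) the qualitative input is IN
THE TREE, so the lever closes up to the construction:

* **`palasekTowerBreakdown_not_heredityFromTwo_of_unforced_noSwirl_stage`** — a pinned (`Λ = 8`,
  `θ = 6/5`) rigid quiet schedule on the wide-base rates with `S.f ≡ 0` on `[0, ∞)` and axisymmetric
  swirl-free datum, carrying a registered stage at some level `k₀ ≥ 2`, REFUTES the child — NO cap, NO
  named fact, NO other hypothesis (global solution from `axisymmetric_no_swirl_global_regularity_holds`,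
  then p446478's `palasekTowerBreakdown_heredityFromTwo_no_global_solution`);
* `palasekTowerBreakdown_heredityFromTwo_isEmpty_unforced_noSwirl_stage` — equivalently, UNDER the
  child that sterile unforced class has NO registered stage at ANY level `k ≥ 2`;
* the PARENT `EpisodeInduction` (= `HeredityFrom 1`) likewise, from level `k₀ ≥ 1`
  (`palasekTowerBreakdown_not_episodeInduction_of_unforced_noSwirl_stage`, via the level-`≥ 1` ladder
  `palasekTowerBreakdown_episodeInduction_nonempty_stage_all`);
* NOT for the sibling 19249 `HeredityAtOne` alone: one hand-over `1 → 2` yields one more stage, not a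
  tower, so a refutation there needs a QUANTITATIVE cap below `c₁Y₂` (planner l.3948) — not typed here.

References: P. G. Lemarié-Rieusset, *The Navier–Stokes Problem in the 21st Century* (CRC 2016), Thm. 10.4
[cite: LemarieRieusset2016, Thm 10.4 (p. 285)]; T. Tao, Anal. PDE 6 (2013), Cor. 11.4
[cite: Tao2011, Cor. 11.4]; S. Palasek, arXiv:2605.13827 §4 [cite: Palasek2026ElementaryModel, §4].
-/

-- `Summit.<Summit>.<Problem>` is the tree's mandated summit-side namespace (CONVENTIONS §2); for this
-- single-conjunct summit the two coincide, so the duplicate is deliberate.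
set_option linter.dupNamespace false

noncomputable section

namespace Summit.NavierStokesRegularity.NavierStokesRegularity.Theorems

open Set MeasureTheory Filter Topology Function
open scoped ENNReal ContDiff
open Summit.NavierStokesRegularity.NavierStokesRegularity.Theses
open Summit.NavierStokesRegularity.FluidComputer.PalasekTowerClayBridge
open Literature.Analysis.FluidPDE

section Sterile

variable {S : Schedule TowerRates.wide}

/-- **An unforced axisymmetric swirl-free design that carries any stage has a GLOBAL classical
finite-energy solution on `[0, S.T]`** (the tree's discharged Ladyzhenskaya / Ukhovskii–Yudovich
theorem, fed with the Clay datum `S.u₀` — smooth and divergence free as the slice `t = 0` of the stage —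
and the zero force relabelled as `S.f`). [cite: LemarieRieusset2016, Thm 10.4 (p. 285)] -/
theorem palasekTowerBreakdown_exists_global_solution_of_unforced_noSwirl {ν : ℝ} (hν : 0 < ν)
    {m : Margins TowerRates.wide} {k : ℕ} (s : Stage ν TowerRates.wide S m k)
    (hf : ∀ t, 0 ≤ t → ∀ x, S.f t x = 0) (h0A : IsAxisymmetric S.u₀) (h0S : HasNoSwirl S.u₀)
    {T' : ℝ} (hT' : 0 < T') :
    ∃ (U : ℝ → EuclideanSpace ℝ (Fin 3) → EuclideanSpace ℝ (Fin 3))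
      (P : ℝ → EuclideanSpace ℝ (Fin 3) → ℝ),
      IsClassicalNSSolutionOn (Icc 0 T') ν S.f U P ∧ U 0 = S.u₀ ∧
      (∃ C : ℝ≥0∞, C < ⊤ ∧ ∀ t ∈ Icc 0 T', ∫⁻ x, ‖U t x‖ₑ ^ 2 ≤ C) ∧
      ∀ t ∈ Icc 0 T', IsAxisymmetric (U t) ∧ HasNoSwirl (U t) := by
  have hsmooth : ContDiff ℝ ∞ S.u₀ := s.contDiff_datum
  have hdiv : VectorCalculus.IsDivFree S.u₀ := by
    rw [← s.initial]
    exact s.classical.divFree 0 ⟨le_rfl, (S.τ_pos k).le⟩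
  obtain ⟨U, P, hcl, hU0, ⟨C, hC, hCb⟩, hsym⟩ :=
    axisymmetric_no_swirl_global_regularity_holds ν hν S.u₀ hsmooth hdiv S.datum_decay h0A h0S
  refine ⟨U, P, ?_, hU0, ⟨C, hC, fun t ht => hCb t ht.1⟩, fun t ht => hsym t ht.1⟩
  exact (hcl.mono Icc_subset_Ici_self (uniqueDiffOn_Icc hT')).congr_force
    fun t ht x => (hf t ht.1 x).symm

/-- **THE REFUTATION TEMPLATE OF RECORD FOR THE CHILD, cap discharged**: a pinned (`Λ = 8`, `θ = 6/5`)
rigid quiet schedule `S` on the wide-base rates with force `S.f ≡ 0` on `[0, ∞)` and axisymmetric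
swirl-free datum, carrying a registered (globally anchored, route margins, unit viscosity) stage at
some level `k₀ ≥ 2`, REFUTES `HeredityFromTwo` — the design's global classical solution
(`axisymmetric_no_swirl_global_regularity_holds`) contradicts the scheduled blow-up the child would
force on it (`palasekTowerBreakdown_heredityFromTwo_no_global_solution`). The stage is NOT constructed
here (open; possibly impossible for kinematic reasons). [cite: LemarieRieusset2016, Thm 10.4 (p. 285); Palasek2026ElementaryModel, §4] -/
theorem palasekTowerBreakdown_not_heredityFromTwo_of_unforced_noSwirl_stage (hP : S.Pins 8 (6 / 5))
    (hR : S.Rigid) (hQ : S.Quiet) (hf : ∀ t, 0 ≤ t → ∀ x, S.f t x = 0) (h0A : IsAxisymmetric S.u₀)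
    (h0S : HasNoSwirl S.u₀) {k₀ : ℕ} (hk₀ : 2 ≤ k₀)
    (s : Stage 1 TowerRates.wide S (Margins.routeG TowerRates.wide) k₀) :
    ¬ PalasekTowerBreakdown.HeredityFromTwo := by
  intro h
  obtain ⟨U, P, hU, hU0, hUE, -⟩ :=
    palasekTowerBreakdown_exists_global_solution_of_unforced_noSwirl one_pos s hf h0A h0S S.T_pos
  exact palasekTowerBreakdown_heredityFromTwo_no_global_solution h hP hR hQ hk₀ s le_rfl hU hU0 hUE

/-- **Under the child, the unforced axisymmetric swirl-free register is EMPTY at every generic level**: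
`HeredityFromTwo →` for every pinned rigid quiet wide schedule with `S.f ≡ 0` on `[0, ∞)` and
axisymmetric swirl-free datum and every `k ≥ 2`, `IsEmpty (Stage 1 TowerRates.wide S routeG k)` — the
child holds VACUOUSLY on that class or not at all. [cite: LemarieRieusset2016, Thm 10.4 (p. 285); Palasek2026ElementaryModel, §4] -/
theorem palasekTowerBreakdown_heredityFromTwo_isEmpty_unforced_noSwirl_stage
    (h : PalasekTowerBreakdown.HeredityFromTwo) (hP : S.Pins 8 (6 / 5)) (hR : S.Rigid) (hQ : S.Quiet)
    (hf : ∀ t, 0 ≤ t → ∀ x, S.f t x = 0) (h0A : IsAxisymmetric S.u₀) (h0S : HasNoSwirl S.u₀) {k : ℕ}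
    (hk : 2 ≤ k) : IsEmpty (Stage 1 TowerRates.wide S (Margins.routeG TowerRates.wide) k) :=
  ⟨fun s => palasekTowerBreakdown_not_heredityFromTwo_of_unforced_noSwirl_stage hP hR hQ hf h0A h0S hk
    s h⟩

/-- `∃`-form of the template: «some unforced axisymmetric swirl-free pinned rigid quiet wide design
carries a registered stage at a level `≥ 2`» refutes the child. This `∃` is the ONE open object of the
Negative lane against 19250 in the sterile class (a `RungG`-type construction). [cite: Palasek2026ElementaryModel, §4] -/
theorem palasekTowerBreakdown_not_heredityFromTwo_of_exists_unforced_noSwirl_rung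
    (hW : ∃ (S : Schedule TowerRates.wide) (k : ℕ), S.Pins 8 (6 / 5) ∧ S.Rigid ∧ S.Quiet ∧
      (∀ t, 0 ≤ t → ∀ x, S.f t x = 0) ∧ IsAxisymmetric S.u₀ ∧ HasNoSwirl S.u₀ ∧ 2 ≤ k ∧
      Nonempty (Stage 1 TowerRates.wide S (Margins.routeG TowerRates.wide) k)) :
    ¬ PalasekTowerBreakdown.HeredityFromTwo := by
  obtain ⟨S, k, hP, hR, hQ, hf, h0A, h0S, hk, ⟨s⟩⟩ := hW
  exact palasekTowerBreakdown_not_heredityFromTwo_of_unforced_noSwirl_stage hP hR hQ hf h0A h0S hk s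

end Sterile

/-! ## The parent crux `EpisodeInduction` (= `HeredityFrom 1`): the same from level `k₀ ≥ 1` -/

section Parent

variable {S : Schedule TowerRates.wide}

/-- Up-and-down the ladder for the PARENT: under `EpisodeInduction`, one registered stage of a pinned
rigid quiet schedule at a level `k₀ ≥ 1` gives a registered stage of the SAME schedule at every level.
[cite: Palasek2026ElementaryModel, §4] -/
theorem palasekTowerBreakdown_episodeInduction_nonempty_stage_all
    (h : PalasekTowerBreakdown.EpisodeInduction) (hP : S.Pins 8 (6 / 5)) (hR : S.Rigid) (hQ : S.Quiet)
    {k₀ : ℕ} (hk₀ : 1 ≤ k₀) (s : Stage 1 TowerRates.wide S (Margins.routeG TowerRates.wide) k₀)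
    (k : ℕ) : Nonempty (Stage 1 TowerRates.wide S (Margins.routeG TowerRates.wide) k) := by
  rcases le_total k₀ k with hk | hk
  · induction k, hk using Nat.le_induction with
    | base => exact ⟨s⟩
    | succ k hk ih =>
      obtain ⟨s'⟩ := ih
      obtain ⟨s'', -⟩ := h S hP hR hQ k (hk₀.trans hk) s'
      exact ⟨s''⟩
  · exact ⟨s.restrictOfAntitone (Margins.antitone_routeG TowerRates.wide) hk⟩

/-- **Under the parent, a design with a registered stage at a level `≥ 1` has no classical
finite-energy solution on `[0, T']`, `S.T ≤ T'`** (the level-`2` stage produced by the parent feeds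
p446478's `palasekTowerBreakdown_heredityFromTwo_no_global_solution` with the child extracted from the
parent). [cite: Palasek2026ElementaryModel, §4; Tao2011, Cor. 11.4] -/
theorem palasekTowerBreakdown_episodeInduction_no_global_solution
    (h : PalasekTowerBreakdown.EpisodeInduction) (hP : S.Pins 8 (6 / 5)) (hR : S.Rigid) (hQ : S.Quiet)
    {k₀ : ℕ} (hk₀ : 1 ≤ k₀) (s : Stage 1 TowerRates.wide S (Margins.routeG TowerRates.wide) k₀)
    {T' : ℝ} (hT' : S.T ≤ T') {U : ℝ → EuclideanSpace ℝ (Fin 3) → EuclideanSpace ℝ (Fin 3)}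
    {P : ℝ → EuclideanSpace ℝ (Fin 3) → ℝ} (hU : IsClassicalNSSolutionOn (Icc 0 T') 1 S.f U P)
    (hU0 : U 0 = S.u₀) (hUE : ∃ C : ℝ≥0∞, C < ⊤ ∧ ∀ t ∈ Icc 0 T', ∫⁻ x, ‖U t x‖ₑ ^ 2 ≤ C) :
    False := by
  obtain ⟨s₂⟩ := palasekTowerBreakdown_episodeInduction_nonempty_stage_all h hP hR hQ hk₀ s 2
  exact palasekTowerBreakdown_heredityFromTwo_no_global_solution
    (EpisodeInductionG.heredityFrom h (by norm_num)) hP hR hQ le_rfl s₂ hT' hU hU0 hUE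

/-- **The refutation template for the PARENT, cap discharged**: an unforced axisymmetric swirl-free
pinned rigid quiet wide design carrying a registered stage at some level `k₀ ≥ 1` refutes
`EpisodeInduction`. (At `k₀ = 1` this is a RungG-1 = `EpisodeBase`-type exhibit inside the sterile
class; not constructed.) [cite: LemarieRieusset2016, Thm 10.4 (p. 285); Palasek2026ElementaryModel, §4] -/
theorem palasekTowerBreakdown_not_episodeInduction_of_unforced_noSwirl_stage (hP : S.Pins 8 (6 / 5))
    (hR : S.Rigid) (hQ : S.Quiet) (hf : ∀ t, 0 ≤ t → ∀ x, S.f t x = 0) (h0A : IsAxisymmetric S.u₀)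
    (h0S : HasNoSwirl S.u₀) {k₀ : ℕ} (hk₀ : 1 ≤ k₀)
    (s : Stage 1 TowerRates.wide S (Margins.routeG TowerRates.wide) k₀) :
    ¬ PalasekTowerBreakdown.EpisodeInduction := by
  intro h
  obtain ⟨U, P, hU, hU0, hUE, -⟩ :=
    palasekTowerBreakdown_exists_global_solution_of_unforced_noSwirl one_pos s hf h0A h0S S.T_pos
  exact palasekTowerBreakdown_episodeInduction_no_global_solution h hP hR hQ hk₀ s le_rfl hU hU0 hUE

/-- Under the parent, the unforced axisymmetric swirl-free register is EMPTY at EVERY level `k ≥ 1`.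
[cite: LemarieRieusset2016, Thm 10.4 (p. 285); Palasek2026ElementaryModel, §4] -/
theorem palasekTowerBreakdown_episodeInduction_isEmpty_unforced_noSwirl_stage
    (h : PalasekTowerBreakdown.EpisodeInduction) (hP : S.Pins 8 (6 / 5)) (hR : S.Rigid) (hQ : S.Quiet)
    (hf : ∀ t, 0 ≤ t → ∀ x, S.f t x = 0) (h0A : IsAxisymmetric S.u₀) (h0S : HasNoSwirl S.u₀) {k : ℕ}
    (hk : 1 ≤ k) : IsEmpty (Stage 1 TowerRates.wide S (Margins.routeG TowerRates.wide) k) :=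
  ⟨fun s => palasekTowerBreakdown_not_episodeInduction_of_unforced_noSwirl_stage hP hR hQ hf h0A h0S hk
    s h⟩

end Parent

end Summit.NavierStokesRegularity.NavierStokesRegularity.Theorems

end
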